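import Summits.CriticalPhenomena.CardyFormulaZ2.Theorems.CardyFlipRussoVoronoiHubFromSmirnovDefs
import Literature.Topology.PlaneTopology.ConnectedImKleinen
import Mathlib.Analysis.SpecificLimits.Basic
import Mathlib.Topology.Connected.PathConnected
import HarnessLib

/-!
# Peano continua are path connected (stub `stub_peanoPathConnected`, S0′a)

Closing file `--supports stmt-CriticalPhenomena-6433` (line `moebius-exact-delaunay-dilation-ward`,
registered stub S0′a `stub_peanoPathConnected` of the crux `VoronoiHubFromSmirnov`): the classical
theorem of R. L. Moore (1916) and S. Mazurkiewicz (1920) that **a compact connected metric space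
which is connected im kleinen at each of its points is arcwise (here: path) connected** (Kuratowski,
*Topology* II §50 II Thm 1; Whyburn, *Analytic Topology* I (12.5), II (5.1); Nadler, *Continuum
Theory* 8.23; Willard 31.2), absent from Mathlib (which has `LocPathConnectedSpace` but no passage
from local connectedness to local PATH connectedness).  Everything except the last five lines is
stated for a general metric space `X`.

Proof (Kelley / Kuratowski §50, cover-free version).  By
`Literature.Topology.PlaneTopology.isUniformlyLocallyConnected_of_forall_isCIKAt` a compact set `M`
connected im kleinen everywhere is uniformly locally connected: points of `M` at distance `< δ(η)`
lie in a sub-continuum of `M` of radius `≤ η` about the first point.  In a preconnected set any two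
points are joined by an `ε`-chain for every `ε` (`exists_chain_of_isPreconnected`,
`IsPreconnected.induction₂'`).  Hence (scales `η_k = 2^{-k-1}`, `δ_k = min (δ(η_k), η_k)`): a
`δ_0`-chain `x = c₀ 0, …, c₀ P₀ = y` in `M`, and inductively each consecutive pair of the level-`k`
chain (at distance `< δ_k`) is joined inside its small continuum by a `δ_{k+1}`-chain staying within
`η_k` of the left point; padding all inserted chains of one level to a common length `N_k`
(`exists_refine_chain`) makes level `k` a map `c k : {0, …, P_k} → M` with `P_{k+1} = P_k N_k` and
`dist (c (k+1) n) (c k (n / N_k)) ≤ η_k`.  The step maps `u_k t = c k ⌊t P_k⌋₊` on `[0, 1]` then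
satisfy `dist (u_k t) (u_{k+1} t) ≤ η_k` (`⌊t P_k N⌋₊ / N = ⌊t P_k⌋₊`), so converge (uniformly) in
the complete set `M` to `f` with `dist (u_k t) (f t) ≤ 2^{-k}`; for `|s - t| < 1/(P_k + 1)` the
level-`k` indices of `s, t` differ by at most one, so `dist (u_k s) (u_k t) < δ_k ≤ 2^{-k}` and
`dist (f s) (f t) ≤ 3 · 2^{-k}`: `f` is continuous, `f 0 = x`, `f 1 = y`, `f [0,1] ⊆ M`
(`joinedIn_of_refinable_chains`, `JoinedIn.ofLine`).  No arcs (injective paths) are produced; the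
crux only needs paths.

References: K. Kuratowski, *Topology* II (1968), §50 II; G. T. Whyburn, *Analytic Topology*
(1942), I §12, II §5; S. B. Nadler, *Continuum Theory* (1992), Thm 8.23; S. Willard, *General
Topology* (1970), 31.2.
-/

noncomputable section

namespace Summit.CriticalPhenomena.CardyFormulaZ2.Cruxes.VoronoiHubFromSmirnov.MoebiusExactDelaunayDilationWard

open scoped Topology unitInterval
open Set Filter Metric
open Literature.Topology.PlaneTopology

variable {X : Type*} [MetricSpace X]

/-! ### `ε`-chains -/

/-- **`ε`-chains in preconnected sets.** In a preconnected subset `S` of a metric space any two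
points `a, b` are joined, for every `ε > 0`, by an `ε`-chain of points of `S`: an eventually
constant sequence `q : ℕ → X` in `S` with `q 0 = a`, `q j = b` for `j ≥ m`, and consecutive points
at distance `< ε` (the relation "joined by an `ε`-chain in `S`" and its converse hold near every
point, and it is transitive by concatenation; `IsPreconnected.induction₂'`).  Kuratowski II §46;
Whyburn I (8.1). -/
theorem exists_chain_of_isPreconnected {S : Set X} (hS : IsPreconnected S) {ε : ℝ} (hε : 0 < ε)
    {a b : X} (ha : a ∈ S) (hb : b ∈ S) :
    ∃ q : ℕ → X, ∃ m : ℕ, q 0 = a ∧ (∀ j, m ≤ j → q j = b) ∧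
      (∀ j, dist (q j) (q (j + 1)) < ε) ∧ ∀ j, q j ∈ S := by
  -- one-step chains between points at distance `< ε`
  have one : ∀ x ∈ S, ∀ y ∈ S, dist x y < ε → ∃ q : ℕ → X, ∃ m : ℕ, q 0 = x ∧
      (∀ j, m ≤ j → q j = y) ∧ (∀ j, dist (q j) (q (j + 1)) < ε) ∧ ∀ j, q j ∈ S := by
    intro x hx y hy hxy
    refine ⟨fun j => if j = 0 then x else y, 1, if_pos rfl, fun j hj => if_neg (by omega),
      fun j => ?_, fun j => ?_⟩
    · rcases Nat.eq_zero_or_pos j with rfl | hj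
      · simpa using hxy
      · simp [hj.ne', hε]
    · by_cases hj : j = 0 <;> simp [hj, hx, hy]
  refine hS.induction₂' (fun a b => ∃ q : ℕ → X, ∃ m : ℕ, q 0 = a ∧ (∀ j, m ≤ j → q j = b) ∧
      (∀ j, dist (q j) (q (j + 1)) < ε) ∧ ∀ j, q j ∈ S) ?_ ?_ ha hb
  · intro x hx
    filter_upwards [inter_mem_nhdsWithin S (ball_mem_nhds x hε)] with y hy
    exact ⟨one x hx y hy.1 (mem_ball'.1 hy.2), one y hy.1 x hx (mem_ball.1 hy.2)⟩
  · rintro x y z - - - ⟨q, m, hq0, hqm, hqd, hqS⟩ ⟨q', m', hq0', hqm', hqd', hqS'⟩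
    refine ⟨fun j => if j < m then q j else q' (j - m), m + m', ?_, ?_, ?_, ?_⟩
    · rcases Nat.eq_zero_or_pos m with rfl | hm
      · simp only [Nat.lt_irrefl, if_false, Nat.sub_zero]
        rw [hq0', ← hqm 0 le_rfl, hq0]
      · simp [hm, hq0]
    · intro j hj
      have : ¬ j < m := by omega
      simp only [this, if_false]
      exact hqm' _ (by omega)
    · intro j
      by_cases h1 : j + 1 < m
      · have h2 : j < m := by omega
        simp only [h1, h2, if_true]
        exact hqd j
      · by_cases h2 : j < m
        · have hm : j + 1 = m := by omega
          simp only [h2, h1, if_true, if_false]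
          rw [hm, Nat.sub_self, hq0', ← hqm m le_rfl, ← hm]
          exact hqd j
        · simp only [h1, h2, if_false]
          rw [show j + 1 - m = (j - m) + 1 by omega]
          exact hqd' _
    · intro j
      by_cases h : j < m <;> simp [h, hqS, hqS']

/-- **Uniform refinement of a chain.** Let `c 0 = x, …, c P = y` be points of `M` with
consecutive distances `< d`, and suppose any two points `a, b ∈ M` at distance `< d` are joined by
a `d'`-chain of points of `M` within distance `r` of `a`.  Then there are `N ≥ 1` and a `d'`-chain
`c' 0 = x, …, c' (P N) = y` of points of `M` whose `n`-th point is within `r` of `c (n / N)`: insert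
between `c i` and `c (i+1)` the given chain, padded (by repeating `c (i+1)`) to the common length
`N = 1 + max m_i` (combinatorial step of the Moore–Mazurkiewicz construction, Kuratowski II
§50). -/
theorem exists_refine_chain {M : Set X} {x y : X} {d d' r : ℝ} (hr : 0 ≤ r)
    (hM : ∀ a ∈ M, ∀ b ∈ M, dist a b < d → ∃ q : ℕ → X, ∃ m : ℕ, q 0 = a ∧
      (∀ j, m ≤ j → q j = b) ∧ (∀ j, dist (q j) (q (j + 1)) < d') ∧
      ∀ j, q j ∈ M ∧ dist (q j) a ≤ r)
    {P : ℕ} {c : ℕ → X} (hc0 : c 0 = x) (hcP : c P = y) (hcM : ∀ i ≤ P, c i ∈ M)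
    (hcd : ∀ i < P, dist (c i) (c (i + 1)) < d) :
    ∃ N : ℕ, ∃ c' : ℕ → X, 0 < N ∧ c' 0 = x ∧ c' (P * N) = y ∧ (∀ n ≤ P * N, c' n ∈ M) ∧
      (∀ n < P * N, dist (c' n) (c' (n + 1)) < d') ∧
      ∀ n ≤ P * N, dist (c' n) (c (n / N)) ≤ r := by
  -- a chain for each consecutive pair (trivial ones beyond the last index)
  have key : ∀ i : ℕ, ∃ q : ℕ → X, ∃ m : ℕ, q 0 = c i ∧ (∀ j, m ≤ j → q j = c (i + 1)) ∧
      (i < P → (∀ j, dist (q j) (q (j + 1)) < d') ∧ ∀ j, q j ∈ M ∧ dist (q j) (c i) ≤ r) := by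
    intro i
    by_cases hi : i < P
    · obtain ⟨q, m, h0, hm, hd, hM'⟩ :=
        hM (c i) (hcM i hi.le) (c (i + 1)) (hcM (i + 1) hi) (hcd i hi)
      exact ⟨q, m, h0, hm, fun _ => ⟨hd, hM'⟩⟩
    · exact ⟨fun j => if j = 0 then c i else c (i + 1), 1, if_pos rfl,
        fun j hj => if_neg (by omega), fun h => absurd h hi⟩
  choose q m hq0 hqm hq using key
  -- a common length `N` for all the inserted chains
  set N : ℕ := (Finset.range P).sup m + 1 with hN
  have hmN : ∀ i < P, m i ≤ N := fun i hi =>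
    (Finset.le_sup (f := m) (Finset.mem_range.2 hi)).trans (Nat.le_succ _)
  have hNpos : 0 < N := Nat.succ_pos _
  set c' : ℕ → X := fun n => q (n / N) (n % N) with hc'
  -- values of the refined chain
  have hA : ∀ i j, j < N → c' (N * i + j) = q i j := by
    intro i j hj
    simp only [hc', Nat.mul_add_div hNpos, Nat.mul_add_mod, Nat.div_eq_of_lt hj,
      Nat.mod_eq_of_lt hj, add_zero]
  have hB : ∀ i < P, c' (N * i + N) = q i N := by
    intro i hi
    have h1 : N * i + N = N * (i + 1) + 0 := by ring
    rw [hqm i N (hmN i hi), h1, hA _ _ hNpos, hq0]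
  have hAB : ∀ i < P, ∀ j ≤ N, c' (N * i + j) = q i j := by
    intro i hi j hj
    rcases hj.lt_or_eq with hj | rfl
    · exact hA i j hj
    · exact hB i hi
  -- every index decomposes
  have hdec : ∀ n, ∃ i j, j < N ∧ n = N * i + j := fun n =>
    ⟨n / N, n % N, Nat.mod_lt n hNpos, (Nat.div_add_mod n N).symm⟩
  refine ⟨N, c', hNpos, ?_, ?_, ?_, ?_, ?_⟩
  · rw [show (0 : ℕ) = N * 0 + 0 by simp, hA 0 0 hNpos, hq0, hc0]
  · rw [show P * N = N * P + 0 by ring, hA P 0 hNpos, hq0, hcP]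
  · intro n hn
    obtain ⟨i, j, hj, rfl⟩ := hdec n
    have hiP : i ≤ P := by
      refine Nat.le_of_mul_le_mul_left ?_ hNpos
      calc N * i ≤ N * i + j := Nat.le_add_right _ _
        _ ≤ P * N := hn
        _ = N * P := mul_comm _ _
    rcases hiP.lt_or_eq with hi | rfl
    · rw [hA i j hj]
      exact ((hq i hi).2 j).1
    · have hj0 : j = 0 := by
        rw [mul_comm] at hn
        omega
      subst hj0
      rw [hA _ 0 hNpos, hq0]
      exact hcM _ le_rfl
  · intro n hn
    obtain ⟨i, j, hj, rfl⟩ := hdec n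
    have hi : i < P := by
      refine Nat.lt_of_mul_lt_mul_left (a := N) ?_
      calc N * i ≤ N * i + j := Nat.le_add_right _ _
        _ < P * N := hn
        _ = N * P := mul_comm _ _
    rw [hAB i hi j hj.le, add_assoc, hAB i hi (j + 1) hj]
    exact (hq i hi).1 j
  · intro n hn
    obtain ⟨i, j, hj, rfl⟩ := hdec n
    have hij : (N * i + j) / N = i := by
      rw [Nat.mul_add_div hNpos, Nat.div_eq_of_lt hj, add_zero]
    rw [hij, hA i j hj]
    have hiP : i ≤ P := by
      refine Nat.le_of_mul_le_mul_left ?_ hNpos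
      calc N * i ≤ N * i + j := Nat.le_add_right _ _
        _ ≤ P * N := hn
        _ = N * P := mul_comm _ _
    rcases hiP.lt_or_eq with hi | rfl
    · exact ((hq i hi).2 j).2
    · have hj0 : j = 0 := by
        rw [mul_comm] at hn
        omega
      subst hj0
      rw [hq0, dist_self]
      exact hr

/-- **Dependent choice along `ℕ`.** If `Q 0 a₀` and every `a` with `Q k a` has a successor `b`
with `Q (k+1) b ∧ R k a b`, then some sequence satisfies `Q k (f k)` and `R k (f k) (f (k+1))` for
all `k` (primitive recursion on a choice function). -/
theorem exists_seq_of_step {α : Type*} (Q : ℕ → α → Prop) (R : ℕ → α → α → Prop) {a₀ : α}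
    (h0 : Q 0 a₀) (h : ∀ k a, Q k a → ∃ b, Q (k + 1) b ∧ R k a b) :
    ∃ f : ℕ → α, (∀ k, Q k (f k)) ∧ ∀ k, R k (f k) (f (k + 1)) := by
  haveI : Nonempty α := ⟨a₀⟩
  choose! g hg using h
  refine ⟨fun k => Nat.rec a₀ (fun k a => g k a) k, fun k => ?_, fun k => ?_⟩
  · induction k with
    | zero => exact h0
    | succ k ih => exact (hg k _ ih).1
  · have hQ : ∀ k, Q k (Nat.rec a₀ (fun k a => g k a) k : α) := by
      intro k
      induction k with
      | zero => exact h0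
      | succ k ih => exact (hg k _ ih).1
    exact (hg k _ (hQ k)).2

/-! ### The path -/

/-- **Paths from refinable chains** (the analytic half of the Moore–Mazurkiewicz theorem).  Let `M`
be a complete subset of a metric space, `δ k ≤ 2^{-k}`, suppose `x, y` are joined by a `δ 0`-chain
in `M` and that any `a, b ∈ M` with `dist a b < δ k` are joined by a `δ (k+1)`-chain of points of
`M` within `2^{-k-1}` of `a`.  Then `x` and `y` are joined by a path in `M`: the uniformly refined
chains
(`exists_refine_chain`, `exists_seq_of_step`) give step maps `t ↦ c k ⌊t P_k⌋₊` on `[0, 1]` at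
sup-distance `≤ 2^{-k-1}` from one another, converging in `M` to a map `f` with
`dist (f s) (f t) ≤ 3 · 2^{-k}` whenever `|s - t| < 1 / (P_k + 1)`, `f 0 = x`, `f 1 = y`.
Kuratowski II §50 II Thm 1 (proof); Whyburn II (5.1). -/
theorem joinedIn_of_refinable_chains {M : Set X} (hM : IsComplete M) {x y : X} {δ : ℕ → ℝ}
    (hδ : ∀ k, δ k ≤ 1 / 2 ^ k)
    (h0 : ∃ q : ℕ → X, ∃ m : ℕ, q 0 = x ∧ (∀ j, m ≤ j → q j = y) ∧
      (∀ j, dist (q j) (q (j + 1)) < δ 0) ∧ ∀ j, q j ∈ M)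
    (hstep : ∀ k, ∀ a ∈ M, ∀ b ∈ M, dist a b < δ k → ∃ q : ℕ → X, ∃ m : ℕ, q 0 = a ∧
      (∀ j, m ≤ j → q j = b) ∧ (∀ j, dist (q j) (q (j + 1)) < δ (k + 1)) ∧
      ∀ j, q j ∈ M ∧ dist (q j) a ≤ 1 / 2 / 2 ^ k) :
    JoinedIn M x y := by
  /- 1. The levels: chains `c k 0, …, c k (P k)` of points of `M` from `x` to `y` at scale `δ k`,
  level `k + 1` refining level `k` uniformly (`P (k+1) = P k * N`) within `1/2/2^k`. -/
  obtain ⟨P, c, hx', hy', hmem, hd, hL⟩ : ∃ (P : ℕ → ℕ) (c : ℕ → ℕ → X), (∀ k, c k 0 = x) ∧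
      (∀ k, c k (P k) = y) ∧ (∀ k, ∀ i ≤ P k, c k i ∈ M) ∧
      (∀ k, ∀ i < P k, dist (c k i) (c k (i + 1)) < δ k) ∧
      ∀ k, ∃ N, 0 < N ∧ P (k + 1) = P k * N ∧
        ∀ n ≤ P k * N, dist (c (k + 1) n) (c k (n / N)) ≤ 1 / 2 / 2 ^ k := by
    obtain ⟨q₀, m₀, hq0, hqm, hqd, hqM⟩ := h0
    obtain ⟨F, hF, hR⟩ := exists_seq_of_step
      (fun k (Pc : ℕ × (ℕ → X)) => Pc.2 0 = x ∧ Pc.2 Pc.1 = y ∧ (∀ i ≤ Pc.1, Pc.2 i ∈ M) ∧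
        ∀ i < Pc.1, dist (Pc.2 i) (Pc.2 (i + 1)) < δ k)
      (fun k (Pc Pc' : ℕ × (ℕ → X)) => ∃ N, 0 < N ∧ Pc'.1 = Pc.1 * N ∧
        ∀ n ≤ Pc.1 * N, dist (Pc'.2 n) (Pc.2 (n / N)) ≤ 1 / 2 / 2 ^ k)
      (a₀ := (m₀, q₀)) ⟨hq0, hqm m₀ le_rfl, fun i _ => hqM i, fun i _ => hqd i⟩ (by
        rintro k ⟨Pk, ck⟩ ⟨h1, h2, h3, h4⟩
        obtain ⟨N, c', hN, h1', h2', h3', h4', h5'⟩ :=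
          exists_refine_chain (by positivity) (hstep k) h1 h2 h3 h4
        exact ⟨(Pk * N, c'), ⟨h1', h2', h3', h4'⟩, N, hN, rfl, h5'⟩)
    exact ⟨fun k => (F k).1, fun k => (F k).2, fun k => (hF k).1, fun k => (hF k).2.1,
      fun k => (hF k).2.2.1, fun k => (hF k).2.2.2, hR⟩
  /- 2. The step maps `t ↦ c k ⌊t * P k⌋₊` converge uniformly on `[0, 1]`. -/
  have hfloor_le : ∀ k, ∀ t ∈ I, ⌊t * (P k : ℝ)⌋₊ ≤ P k := fun k t ht =>
    Nat.floor_le_of_le (mul_le_of_le_one_left (Nat.cast_nonneg _) ht.2)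
  have hu_mem : ∀ k, ∀ t ∈ I, c k ⌊t * (P k : ℝ)⌋₊ ∈ M := fun k t ht => hmem k _ (hfloor_le k t ht)
  have hu_succ : ∀ k, ∀ t ∈ I,
      dist (c k ⌊t * (P k : ℝ)⌋₊) (c (k + 1) ⌊t * (P (k + 1) : ℝ)⌋₊) ≤ 1 / 2 / 2 ^ k := by
    intro k t ht
    obtain ⟨N, hN, hPN, hlk⟩ := hL k
    have h1 : ⌊t * (P (k + 1) : ℝ)⌋₊ / N = ⌊t * (P k : ℝ)⌋₊ := by
      rw [hPN, Nat.cast_mul, ← mul_assoc, Nat.mul_cast_floor_div_cancel hN.ne']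
    rw [dist_comm, ← h1]
    refine hlk _ ?_
    rw [← hPN]
    exact hfloor_le (k + 1) t ht
  have hlim : ∀ t, ∃ v, t ∈ I → v ∈ M ∧ Tendsto (fun k => c k ⌊t * (P k : ℝ)⌋₊) atTop (𝓝 v) := by
    intro t
    by_cases ht : t ∈ I
    · obtain ⟨v, hv, hvt⟩ := cauchySeq_tendsto_of_isComplete hM (fun k => hu_mem k t ht)
        (cauchySeq_of_le_geometric_two (C := 1) fun k => hu_succ k t ht)
      exact ⟨v, fun _ => ⟨hv, hvt⟩⟩
    · exact ⟨x, fun h => absurd h ht⟩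
  choose f hf using hlim
  have hft : ∀ t ∈ I, ∀ k, dist (c k ⌊t * (P k : ℝ)⌋₊) (f t) ≤ 1 / 2 ^ k := fun t ht k =>
    dist_le_of_le_geometric_two_of_tendsto (C := 1) (fun k => hu_succ k t ht) (hf t ht).2 k
  /- 3. The limit map is a path in `M` from `x` to `y`. -/
  refine JoinedIn.ofLine (f := f) ?_ ?_ ?_ ?_
  · refine Metric.continuousOn_iff.2 fun t ht ε hε => ?_
    obtain ⟨k, hk⟩ : ∃ k : ℕ, (1 : ℝ) / 2 ^ k < ε / 3 := by
      obtain ⟨k, hk⟩ := exists_pow_lt_of_lt_one (by positivity : 0 < ε / 3)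
        (by norm_num : (1 / 2 : ℝ) < 1)
      exact ⟨k, by rwa [one_div_pow] at hk⟩
    refine ⟨1 / ((P k : ℝ) + 1), by positivity, fun s hs hst => ?_⟩
    -- the level-`k` indices of `s` and `t` differ by at most one
    have hI : ∀ {a b : ℝ}, b ∈ I → dist a b < 1 / ((P k : ℝ) + 1) →
        ⌊a * (P k : ℝ)⌋₊ ≤ ⌊b * (P k : ℝ)⌋₊ + 1 := by
      intro a b hb hab
      have hb0 : 0 ≤ b * (P k : ℝ) := mul_nonneg hb.1 (Nat.cast_nonneg _)
      rw [← Nat.floor_add_one hb0]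
      refine Nat.floor_le_floor ?_
      have hPk : (0 : ℝ) ≤ P k := Nat.cast_nonneg _
      have h1 : a - b < 1 / ((P k : ℝ) + 1) := (abs_sub_lt_iff.1 (Real.dist_eq a b ▸ hab)).1
      have h2 : (a - b) * (P k : ℝ) ≤ 1 / ((P k : ℝ) + 1) * (P k : ℝ) :=
        mul_le_mul_of_nonneg_right h1.le hPk
      have h3 : 1 / ((P k : ℝ) + 1) * (P k : ℝ) ≤ 1 := by
        rw [div_mul_eq_mul_div, one_mul]
        exact div_le_one_of_le₀ (by linarith) (by positivity)
      nlinarith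
    have hs1 := hI ht hst
    have ht1 := hI hs (by rwa [dist_comm])
    have hsP := hfloor_le k s hs
    have htP := hfloor_le k t ht
    have hk' : dist (c k ⌊s * (P k : ℝ)⌋₊) (c k ⌊t * (P k : ℝ)⌋₊) ≤ 1 / 2 ^ k := by
      rcases Nat.lt_trichotomy ⌊s * (P k : ℝ)⌋₊ ⌊t * (P k : ℝ)⌋₊ with h | h | h
      · have h' : ⌊t * (P k : ℝ)⌋₊ = ⌊s * (P k : ℝ)⌋₊ + 1 := by omega
        rw [h']
        exact (hd k _ (by omega)).le.trans (hδ k)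
      · rw [h, dist_self]
        positivity
      · have h' : ⌊s * (P k : ℝ)⌋₊ = ⌊t * (P k : ℝ)⌋₊ + 1 := by omega
        rw [h', dist_comm]
        exact (hd k _ (by omega)).le.trans (hδ k)
    calc dist (f s) (f t)
        ≤ dist (f s) (c k ⌊s * (P k : ℝ)⌋₊) + dist (c k ⌊s * (P k : ℝ)⌋₊) (c k ⌊t * (P k : ℝ)⌋₊)
          + dist (c k ⌊t * (P k : ℝ)⌋₊) (f t) := dist_triangle4 _ _ _ _
      _ ≤ 1 / 2 ^ k + 1 / 2 ^ k + 1 / 2 ^ k := by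
          gcongr
          · rw [dist_comm]
            exact hft s hs k
          · exact hft t ht k
      _ < ε := by linarith
  · have h : Tendsto (fun k => c k ⌊(0 : ℝ) * (P k : ℝ)⌋₊) atTop (𝓝 x) := by
      simp only [zero_mul, Nat.floor_zero, hx']
      exact tendsto_const_nhds
    exact tendsto_nhds_unique (hf 0 unitInterval.zero_mem).2 h
  · have h : Tendsto (fun k => c k ⌊(1 : ℝ) * (P k : ℝ)⌋₊) atTop (𝓝 y) := by
      simp only [one_mul, Nat.floor_natCast, hy']
      exact tendsto_const_nhds
    exact tendsto_nhds_unique (hf 1 unitInterval.one_mem).2 h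
  · rintro _ ⟨t, ht, rfl⟩
    exact (hf t ht).1

/-! ### The Moore–Mazurkiewicz theorem -/

/-- **Moore (1916) – Mazurkiewicz (1920): a compact preconnected set which is connected im kleinen
at each of its points is path connected.**  For `M` compact and preconnected in a metric space with
`IsCIKAt M x` for all `x ∈ M`, any two points of `M` are joined by a path in `M`: `M` is uniformly
locally connected (`isUniformlyLocallyConnected_of_forall_isCIKAt`), small continua carry
`ε`-chains for every `ε` (`exists_chain_of_isPreconnected`), and `joinedIn_of_refinable_chains`
applies with the scales `η_k = 2^{-k-1}`, `δ_k = min (δ(η_k)) η_k`.  Kuratowski II §50 II Thm 1;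
Whyburn I (12.5); Nadler 8.23; Willard 31.2. -/
theorem joinedIn_of_isCompact_of_isCIKAt {M : Set X} (hM : IsCompact M) (hMc : IsPreconnected M)
    (hcik : ∀ x ∈ M, IsCIKAt M x) {x y : X} (hx : x ∈ M) (hy : y ∈ M) : JoinedIn M x y := by
  have hulc := isUniformlyLocallyConnected_of_forall_isCIKAt hM hcik
  -- scales `δ k ≤ 1 / 2 ^ k`: points at distance `< δ k` lie in a continuum of radius `1/2/2^k`
  have hsc : ∀ k : ℕ, ∃ d : ℝ, 0 < d ∧ d ≤ 1 / 2 ^ k ∧ ∀ a ∈ M, ∀ b ∈ M, dist a b < d →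
      ∃ B ⊆ M, IsCompact B ∧ IsPreconnected B ∧ a ∈ B ∧ b ∈ B ∧
        B ⊆ closedBall a (1 / 2 / 2 ^ k) := by
    intro k
    obtain ⟨d, hd, hB⟩ := hulc (1 / 2 / 2 ^ k) (by positivity)
    refine ⟨min d (1 / 2 ^ k), lt_min hd (by positivity), min_le_right _ _,
      fun a ha b hb hab => hB a ha b hb (hab.trans_le (min_le_left _ _))⟩
  choose δ hδpos hδle hδB using hsc
  refine joinedIn_of_refinable_chains hM.isComplete hδle
    (exists_chain_of_isPreconnected hMc (hδpos 0) hx hy) fun k a ha b hb hab => ?_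
  obtain ⟨B, hBM, -, hBc, haB, hbB, hBball⟩ := hδB k a ha b hb hab
  obtain ⟨q, m, hq0, hqm, hqd, hqB⟩ := exists_chain_of_isPreconnected hBc (hδpos (k + 1)) haB hbB
  exact ⟨q, m, hq0, hqm, hqd, fun j => ⟨hBM (hqB j), mem_closedBall.1 (hBball (hqB j))⟩⟩

/-- **S0′a — `stub_peanoPathConnected`** (registered stub of the line
`moebius-exact-delaunay-dilation-ward`, crux `VoronoiHubFromSmirnov`): a compact preconnected subset
of `ℂ` which is connected im kleinen at each of its points has any two of its points joined by a
path inside it — `joinedIn_of_isCompact_of_isCIKAt` in the plane (the hypothesis of the stub is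
`∀ x ∈ M, IsCIKAt M x`, spelled out).  Moore 1916 / Mazurkiewicz 1920; Kuratowski II §50 II
Thm 1. -/
theorem stub_peanoPathConnected : Sig.stub_peanoPathConnected :=
  fun _M hM hMc hcik _x hx _y hy => joinedIn_of_isCompact_of_isCIKAt hM hMc hcik hx hy

end Summit.CriticalPhenomena.CardyFormulaZ2.Cruxes.VoronoiHubFromSmirnov.MoebiusExactDelaunayDilationWard

end
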